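import Mathlib

/-!
# `TateLifting` (stmt-KontsevichZagierPeriods-9129), line `Sketch` — stub 39 `ratCompose`

SUBSTITUTION OF RATIONAL FUNCTIONS INTO A BIVARIATE POLYNOMIAL. Let
`K = ℚ̄ ∩ ℝ = algebraicClosure ℚ ℝ` be the field of real algebraic numbers. The genus-zero sector
of the line reduces a one-dimensional representation `[σ, R(x, y(x))]` to the Baker sector by one
change of variables along a rational chart `x = X(t) = pX(t)/qX(t)`, `y = Y(t) = pY(t)/qY(t)`,
`pX, qX, pY, qY ∈ K[t]`. This file is the pure-algebra step of that reduction: for every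
`P ∈ K[X₀, X₁]` there are `p ∈ K[t]` and `N ∈ ℕ` with

  `P(X(t), Y(t)) = p(t) / (qX · qY)(t) ^ N`

as real numbers, for every real `t` at which `qX(t) ≠ 0` and `qY(t) ≠ 0`. The pair `(p, N)` is
built by structural induction on `P` (`MvPolynomial.induction_on`): a constant `a` gives
`(C a, 0)`; a sum gives `(p₁ (qX qY)^{N₂} + p₂ (qX qY)^{N₁}, N₁ + N₂)`; multiplication by `X₀`
(resp. `X₁`) gives `(p₁ · pX · qY, N₁ + 1)` (resp. `(p₁ · pY · qX, N₁ + 1)`).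

References: M. Kontsevich, D. Zagier, *Periods* (2001), §1.2 rule (2) (change of variables).
-/

noncomputable section

open Polynomial

namespace Summit.KontsevichZagierPeriods.InverseLandau

/-- **Substitution of `K`-rational functions into a bivariate `K`-polynomial** (stub 39
`tateLifting_ratCompose` of the lead's skeleton, `K = ℚ̄ ∩ ℝ`): for `P ∈ K[X₀, X₁]` and
`pX, qX, pY, qY ∈ K[t]` there are `p ∈ K[t]` and `N ∈ ℕ` such that
`P(pX(t)/qX(t), pY(t)/qY(t)) = p(t) / (qX qY)(t)^N` for every real `t` with `qX(t) ≠ 0`,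
`qY(t) ≠ 0`. This is the algebraic half of the rational change of variables of rule (2).
[cite: KontsevichZagier2001, §1.2 rule (2)] -/
theorem tateLifting_ratCompose :
    ∀ (P : MvPolynomial (Fin 2) (algebraicClosure ℚ ℝ))
      (pX qX pY qY : Polynomial (algebraicClosure ℚ ℝ)),
      ∃ (p : Polynomial (algebraicClosure ℚ ℝ)) (N : ℕ), ∀ t : ℝ,
        (Polynomial.aeval t qX : ℝ) ≠ 0 → (Polynomial.aeval t qY : ℝ) ≠ 0 →
        (MvPolynomial.aeval ![(Polynomial.aeval t pX : ℝ) / Polynomial.aeval t qX,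
            (Polynomial.aeval t pY : ℝ) / Polynomial.aeval t qY] P : ℝ) =
          (Polynomial.aeval t p : ℝ) / (Polynomial.aeval t (qX * qY) : ℝ) ^ N := by
  intro P pX qX pY qY
  induction P using MvPolynomial.induction_on with
  | C a =>
    refine ⟨Polynomial.C a, 0, fun t _ _ => ?_⟩
    simp [IntermediateField.algebraMap_apply]
  | add p q ihp ihq =>
    obtain ⟨p₁, N₁, h₁⟩ := ihp
    obtain ⟨p₂, N₂, h₂⟩ := ihq
    refine ⟨p₁ * (qX * qY) ^ N₂ + p₂ * (qX * qY) ^ N₁, N₁ + N₂, fun t hqX hqY => ?_⟩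
    rw [map_add, h₁ t hqX hqY, h₂ t hqX hqY]
    simp only [map_add, map_mul, map_pow]
    field_simp
    ring
  | mul_X p i ih =>
    obtain ⟨p₁, N₁, h₁⟩ := ih
    fin_cases i
    · refine ⟨p₁ * pX * qY, N₁ + 1, fun t hqX hqY => ?_⟩
      rw [map_mul, h₁ t hqX hqY, MvPolynomial.aeval_X]
      simp only [Fin.zero_eta, Matrix.cons_val_zero, map_mul, pow_succ]
      field_simp
    · refine ⟨p₁ * pY * qX, N₁ + 1, fun t hqX hqY => ?_⟩
      rw [map_mul, h₁ t hqX hqY, MvPolynomial.aeval_X]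
      simp only [Fin.mk_one, Matrix.cons_val_one, Matrix.cons_val_fin_one, map_mul, pow_succ]
      field_simp

end Summit.KontsevichZagierPeriods.InverseLandau
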